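import Literature.MathematicalPhysics.QuantumFieldTheory.Balaban1983to89.T4ShellMeasureDet

/-!
# `T4Continuum.ShellMeasureWindowCovariant` — (LR)_j FOR A TRANSLATION-COVARIANT GROUP-VALUED AVERAGE: the
# configuration law DISINTEGRATES along the average as (Haar on the values) ⊗ (ONE unit-fibre law) through the
# translates — an explicit push-forward, every fibre, no disintegration theorem; a window centred on a SECTION of
# the average is a ball on the UNIT FIBRE whose centre is frozen with the average value (FIXED for a covariant
# section); END-II applies fibrewise
(cell `pub-balaban`, sub-cell `t4`, spine estimate NE7c (node U5b); NE7c ROUND-2 crew `t4-ne7c-formalise-*`, seat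
leaf-10 (gen 4); continuation of this seat's OFFERED row «(LR)_j with print's fixed centre» (gen 2: p210846 / p211154 /
p211549; gen 3: p212366 / p212682); ADDITIVE — imports `T4ShellMeasureDet` only, modifies nothing; 0 `def`, 0 sorry,
0 cite)

HONEST FRAMING.  Finite four-torus programme, rung (B)+1 only — NOT infinite volume, NOT a mass gap, NOT the Clay
problem, NOT summit progress; (B), `BetaPertHyp`, (B^μ) are not consumed.  (M1) for Bałaban's inductively defined
effective measures is NOT PRINTED (GAPS G-ne7cp1-1), asserted by nobody, NOT moved here.  NE7c ⇐ the named binders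
(trigger c3); NE7c NOT PRINTED, NOT proved; spine PROVED 0/9 before and after.  STRUCTURAL BOOKKEEPING (Fubini +
invariance of Haar measure) — no estimate, no `def` (c2), `[folklore]` throughout.  HONEST DEPENDENCY (cell):
continuum YM on T⁴ ⇐ BetaPertH ∧ nine spine estimates (0/9 proved); BetaPertH ⇐ (D1) ∧ (D4) ∧ CAP+tail; G-an2-4
gates asym, D1 and NE2/3/4.

THE POINT (this seat gen 3, `ShellMeasureWindowSection`, last sentence of its header).  In the MARGINAL reading of
[Balaban1989LargeFieldI] (1.25) the window (1.27) is centred at a SECTION `σ(M y)` of the one-step average `M` of the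
block's own variables `y`; gen 3 closed the case of a LINEAR surjective average `Q : E → F` on a real vector space
(Lebesgue disintegrates along `Q`; the window is a fixed ball on `ker Q`) and left as the residual READING «the
LINEARITY of the average in the variables carrying the product law — the curved fibre of the group-valued average».
THIS FILE replaces LINEARITY by TRANSLATION-COVARIANCE, the property the disintegration actually uses: the
configuration space `X` (any measurable space, finite law `μ`) carries a measurable, `μ`-preserving right action
`act : B → X → X` of the VALUE GROUP `B` of the average (`act 1 = id`, `act (g h) = act h ∘ act g`), Haar
probability `η` on `B` left-invariant, and the average `M : X → B` is COVARIANT: `M (act g x) = M x * g`.  Instances: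
every linear surjection (gen 3: `act b y = y + s b`, `s` a linear right inverse — additive notation); the
DECIMATION / AXIAL average of the tree (`AveragingRT.axialAvg`: right-multiply the last bond of every line,
`AveragingRT.axialAvg_mul_last` — this seat's sibling instance file `ShellMeasureWindowCovariantAxial`); any
«sandwiched distinguished bond» `M (g, r) = a(r) g m(r)` with the field-dependent action `g ↦ a(r)⁻¹ k a(r) g`.
NOT an instance as printed: [Balaban1985Averaging]'s `d = 4` block average is GAUGE-covariant
(`AveragingRT.axialAvg_covariant` is the axial analogue), and the gauge action on coarse fields has holonomy
invariants — NOT transitive; whether a field-dependent translation structure exists for it (direction-adapted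
contours) is a READING, displayed, not asserted.  Then, with the NORMALISATION
`W x := act (M x)⁻¹ x` (a measurable map ONTO THE UNIT FIBRE `{M = 1}`, invariant under the action) and the unit-fibre
law `ν₁ := μ.map W` (an honest push-forward — no conditional measure, no `condKernel`, cf. the a.e.-defined
`T4AveragingDisintegration.condLaw` for general Haar-compatible averages):
* §1 `average_normalise`, `normalise_act`, `act_average_normalise`, `average_translate_unit`,
  `measurable_normalise`, `ae_normalise_unit` (`ν₁` is carried by the unit fibre) — the algebra of the normalisation;
* §2 THE DISINTEGRATION: `measure_fibre_inter_average` (rectangles: `μ(W ∈ S, M ∈ A) = μ(W ∈ S) · η A` — translate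
  the rectangle by `act k`, integrate `k` against `η`, Fubini, left-invariance of `η`), `map_average` (THE LAW OF A
  COVARIANT AVERAGE IS HAAR: `μ.map M = μ(univ) • η` — for the axial average this is `AveragingRT.map_axialAvg`, not
  re-derived there), `map_normalise_average_eq_prod` (`μ.map (W, M) = ν₁ ⊗ η`: the fibre coordinate and the average
  are INDEPENDENT), `measurePreserving_translate` (`(w, g) ↦ act g w` pushes `ν₁ ⊗ η` to `μ`: EVERY fibre `{M = g}` is
  the `act g`-translate of the unit fibre, with law `(act g)_* ν₁` — the «curved fibre chart» is a translate);
* §3 THE WINDOW: `window_translate` — print's window «distance of the configuration from the centre READ OFF ITS OWN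
  AVERAGE `< r`», `1{d(x, σ(M x)) < r}` for an `act`-invariant distance `d` and ANY section-centre `σ : B → X`, at the
  translated point `act g w` of the unit fibre IS the ball `1{d(w, act g⁻¹ (σ g)) < r}` — centre FROZEN with the
  average value `g`; `window_translate_covariant` — for a COVARIANT centre `σ g = act g c` (the shape of print's
  (1.26): `M^j` of a gauge-covariantly built background — READING) it is the FIXED ball `1{d(w, c) < r}`: no `hc`
  (S20), no smallness, no linearity;
* §4 (M1): `slotAC_of_translate` ((M1) for `μ.withDensity G` ⇐ (M1) for `(ν₁ ⊗ η).withDensity (G ∘ translate)`,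
  SAME `θ ρ D` — `T4ShellMeasureDet.slotAntiConcentration_withDensity_map` BY NAME), `slotAC_of_unitFibre` (⇐ (M1) ON
  THE UNIT FIBRE per frozen average value `g` — `T4ShellMeasureLocal.slotAntiConcentration_of_sections` BY NAME),
  `slotAC_covariant_of_fibrewise` (with ANY s-finite exterior law `ζ`: (M1) for the realized slot law
  `((μ.prod ζ).withDensity G)` ⇐ (M1) on the unit fibre per `(z, g)`), and the two window ENDs
  `slotAC_sectionWindow_of_fibrewise` (window about ANY jointly measurable section `σ z (M x)`; per `(z, g)` the
  density on the unit fibre is `1{d(w, act g⁻¹ (σ z g)) < r} · G₀(act g w, z)`) and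
  `slotAC_covariantWindow_of_fibrewise` (covariant centre: the FIXED ball `1{d(w, c z) < r}`).
WHAT THE PER-FIBRE (M1) STILL NEEDS (displayed, unchanged vocabulary): a Euclidean chart of the ONE unit fibre
carrying `ν₁` — the tree's chart binder (CH) (`T4ShellMeasureDet.slotAntiConcentration_of_chart`) or gen 2's fibre END
`ShellMeasureRootCompositionFibre.slotAC_fibre_of_levelData` then supplies it from E2′'s level data; for the axial
average the unit fibre is the graph «last bond of each line = (product of the other bonds of the line)⁻¹» over the
remaining bond variables (sibling instance file), for a
linear average it is `ker Q` (gen 3), for [Balaban1985Averaging]'s nonlinear average it is the implicit-function chart of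
`{U : M(U) = 1}` — DISPLAYED ([dict] push), as before.
CONSEQUENCE FOR THE LEDGER (c3-honest).  The residual READING of (LR)_j after gens 1–4 of this seat: NOT the window
shape (G-ne7cL10-1: displayed), NOT the centre (moving or not, conditional or marginal), NOT linearity, but (T) a
translation structure for the one-step average in the variables carrying the product law (KERNEL for axial/decimation
and linear averages; a READING for B3's block average) + (CH)_fib a chart of one unit fibre.  Nothing printed is
asserted; no instance of SM-L1/L3/L4/L6 at any `j ≥ 1`; (M1) per slot stays THE wall.
-/

noncomputable section

open Set Function MeasureTheory MeasureTheory.Measure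

namespace Summit.QuantumFields.BalabanUV.T4Continuum.ShellMeasureWindowCovariant

open scoped ENNReal
open Literature.MathematicalPhysics.QuantumFieldTheory.Balaban1983to89
open T4ShellMeasure (SlotAntiConcentration)
open T4ShellMeasureLocal (slotAntiConcentration_of_sections)
open T4ShellMeasureDet (slotAntiConcentration_withDensity_map)

variable {B : Type*} [Group B] {X : Type*} {act : B → X → X} {M : X → B}

/-! ## §1 The translation structure: normalisation onto the unit fibre -/

section Algebra

/-- the NORMALISED configuration `act (M x)⁻¹ x` lies on the UNIT FIBRE `{M = 1}` (covariance). [folklore] -/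
theorem average_normalise (hcov : ∀ g x, M (act g x) = M x * g) (x : X) : M (act (M x)⁻¹ x) = 1 := by
  rw [hcov, mul_inv_cancel]

/-- the normalisation is INVARIANT under the action: `W (act k x) = W x`. [folklore] -/
theorem normalise_act (hmul : ∀ g h x, act (g * h) x = act h (act g x)) (hcov : ∀ g x, M (act g x) = M x * g)
    (k : B) (x : X) : act (M (act k x))⁻¹ (act k x) = act (M x)⁻¹ x := by
  rw [hcov, mul_inv_rev, ← hmul, mul_inv_cancel_left]

/-- RECONSTRUCTION: translating the normalised configuration by the average gives the configuration back,
`act (M x) (W x) = x`. [folklore] -/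
theorem act_average_normalise (hone : ∀ x, act 1 x = x) (hmul : ∀ g h x, act (g * h) x = act h (act g x))
    (x : X) : act (M x) (act (M x)⁻¹ x) = x := by
  rw [← hmul, inv_mul_cancel, hone]

/-- a translate `act g w` of a point `w` of the unit fibre has average `g`. [folklore] -/
theorem average_translate_unit (hcov : ∀ g x, M (act g x) = M x * g) {w : X} (hw : M w = 1) (g : B) :
    M (act g w) = g := by
  rw [hcov, hw, one_mul]

end Algebra

section Measurability

variable [MeasurableSpace B] [MeasurableInv B] [MeasurableSpace X]

/-- the normalisation `x ↦ act (M x)⁻¹ x` is measurable (jointly measurable action, measurable average). [folklore] -/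
theorem measurable_normalise (hact : Measurable fun p : B × X => act p.1 p.2) (hM : Measurable M) :
    Measurable fun x => act (M x)⁻¹ x :=
  hact.comp (hM.inv.prodMk measurable_id)

/-- the unit-fibre law `μ.map W` IS CARRIED BY THE UNIT FIBRE. [folklore] -/
theorem ae_normalise_unit [MeasurableSingletonClass B] (μ : Measure X)
    (hact : Measurable fun p : B × X => act p.1 p.2) (hM : Measurable M) (hcov : ∀ g x, M (act g x) = M x * g) :
    ∀ᵐ w ∂(μ.map fun x => act (M x)⁻¹ x), M w = 1 :=
  (ae_map_iff (measurable_normalise hact hM).aemeasurable (hM (measurableSet_singleton 1))).2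
    (ae_of_all _ fun x => average_normalise hcov x)

end Measurability

/-! ## §2 The disintegration: (fibre coordinate, average) are independent, the average is Haar distributed -/

section Disintegration

variable [MeasurableSpace B] [MeasurableMul₂ B] [MeasurableInv B] [MeasurableSpace X] (η : Measure B)
  [IsProbabilityMeasure η] [η.IsMulLeftInvariant] (μ : Measure X) [IsFiniteMeasure μ]

/-- **RECTANGLES.**  For a translation-covariant average under a `μ`-preserving measurable action and a left-invariant
Haar probability `η` on the value group: `μ {W ∈ S, M ∈ A} = μ {W ∈ S} · η A` for measurable `S ⊆ X`, `A ⊆ B`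
(`W x = act (M x)⁻¹ x` the normalisation).  Proof: the rectangle translated by `act k` is `{W ∈ S, M·k ∈ A}` and has
the same `μ`-measure; integrate `k` against `η` and exchange the integrals (both are `(η ⊗ μ)` of one measurable
set); for fixed `x` the `k`-integral is `1{W x ∈ S} · η((M x)⁻¹ A) = 1{W x ∈ S} · η A`. [folklore] -/
theorem measure_fibre_inter_average (hact : Measurable fun p : B × X => act p.1 p.2)
    (hmul : ∀ g h x, act (g * h) x = act h (act g x)) (hinv : ∀ g, MeasurePreserving (act g) μ μ)
    (hM : Measurable M) (hcov : ∀ g x, M (act g x) = M x * g) {S : Set X} (hS : MeasurableSet S) {A : Set B}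
    (hA : MeasurableSet A) :
    μ ((fun x => act (M x)⁻¹ x) ⁻¹' S ∩ M ⁻¹' A) = μ ((fun x => act (M x)⁻¹ x) ⁻¹' S) * η A := by
  set W : X → X := fun x => act (M x)⁻¹ x with hWdef
  have hW : Measurable W := measurable_normalise hact hM
  -- the test set in `B × X`
  set T : Set (B × X) := {p | W p.2 ∈ S ∧ M p.2 * p.1 ∈ A} with hTdef
  have hT : MeasurableSet T :=
    ((hW.comp measurable_snd) hS).inter (((hM.comp measurable_snd).mul measurable_fst) hA)
  -- slices at fixed `k`: translates of the rectangle, all of the same `μ`-measure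
  have h1 : (η.prod μ) T = μ (W ⁻¹' S ∩ M ⁻¹' A) := by
    rw [Measure.prod_apply hT]
    have hk : ∀ k, μ (Prod.mk k ⁻¹' T) = μ (W ⁻¹' S ∩ M ⁻¹' A) := fun k => by
      have hpre : Prod.mk k ⁻¹' T = act k ⁻¹' (W ⁻¹' S ∩ M ⁻¹' A) := by
        ext x
        simp only [hTdef, hWdef, mem_preimage, mem_setOf_eq, mem_inter_iff]
        rw [normalise_act hmul hcov, hcov]
      rw [hpre]
      exact (hinv k).measure_preimage ((hW hS).inter (hM hA)).nullMeasurableSet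
    simp_rw [hk]
    rw [lintegral_const, measure_univ, mul_one]
  -- slices at fixed `x`: a left translate of `A`, or nothing
  have h2 : (η.prod μ) T = μ (W ⁻¹' S) * η A := by
    rw [Measure.prod_apply_symm hT]
    have hx : ∀ x, η ((fun k => (k, x)) ⁻¹' T) = (W ⁻¹' S).indicator (fun _ => η A) x := fun x => by
      by_cases hxS : W x ∈ S
      · have hpre : (fun k => (k, x)) ⁻¹' T = (fun k => M x * k) ⁻¹' A := by
          ext k
          simp only [hTdef, mem_preimage, mem_setOf_eq]
          exact and_iff_right hxS
        rw [indicator_of_mem (show x ∈ W ⁻¹' S from hxS), hpre,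
          ← Measure.map_apply (measurable_const_mul (M x)) hA, map_mul_left_eq_self]
      · have hpre : (fun k => (k, x)) ⁻¹' T = ∅ := by
          ext k
          simp only [hTdef, mem_preimage, mem_setOf_eq, mem_empty_iff_false, iff_false, not_and]
          exact fun h => absurd h hxS
        rw [indicator_of_notMem (show x ∉ W ⁻¹' S from hxS), hpre, measure_empty]
    simp_rw [hx]
    rw [lintegral_indicator_const (hW hS), mul_comm]
  exact h1.symm.trans h2

/-- **THE LAW OF A TRANSLATION-COVARIANT AVERAGE IS HAAR**: `μ.map M = μ(univ) • η`.  (For the tree's axial average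
this is `AveragingRT.map_axialAvg`; the gauge-covariance of [Balaban1985Averaging]'s average does NOT give it.)
[folklore] -/
theorem map_average (hact : Measurable fun p : B × X => act p.1 p.2)
    (hmul : ∀ g h x, act (g * h) x = act h (act g x)) (hinv : ∀ g, MeasurePreserving (act g) μ μ)
    (hM : Measurable M) (hcov : ∀ g x, M (act g x) = M x * g) : μ.map M = μ univ • η := by
  ext A hA
  rw [Measure.map_apply hM hA, Measure.smul_apply, smul_eq_mul]
  have h := measure_fibre_inter_average η μ hact hmul hinv hM hcov MeasurableSet.univ hA
  rwa [preimage_univ, univ_inter] at h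

/-- **JOINT LAW = PRODUCT**: the normalisation (unit-fibre coordinate) and the average are INDEPENDENT,
`μ.map (W, M) = (μ.map W) ⊗ η`. [folklore] -/
theorem map_normalise_average_eq_prod (hact : Measurable fun p : B × X => act p.1 p.2)
    (hmul : ∀ g h x, act (g * h) x = act h (act g x)) (hinv : ∀ g, MeasurePreserving (act g) μ μ)
    (hM : Measurable M) (hcov : ∀ g x, M (act g x) = M x * g) :
    μ.map (fun x => (act (M x)⁻¹ x, M x)) = (μ.map fun x => act (M x)⁻¹ x).prod η := by
  have hW : Measurable fun x => act (M x)⁻¹ x := measurable_normalise hact hM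
  symm
  refine Measure.prod_eq fun S A hS hA => ?_
  rw [Measure.map_apply (hW.prodMk hM) (hS.prod hA), Measure.map_apply hW hS, mk_preimage_prod]
  exact measure_fibre_inter_average η μ hact hmul hinv hM hcov hS hA

/-- **THE DISINTEGRATION THROUGH THE TRANSLATES**: `(w, g) ↦ act g w` pushes (unit-fibre law) ⊗ (Haar) to `μ` —
every fibre `{M = g}` is the `act g`-translate of the unit fibre and carries `(act g)_* ν₁`; no conditional measure
is involved. [folklore] -/
theorem measurePreserving_translate (hact : Measurable fun p : B × X => act p.1 p.2) (hone : ∀ x, act 1 x = x)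
    (hmul : ∀ g h x, act (g * h) x = act h (act g x)) (hinv : ∀ g, MeasurePreserving (act g) μ μ)
    (hM : Measurable M) (hcov : ∀ g x, M (act g x) = M x * g) :
    MeasurePreserving (fun p : X × B => act p.2 p.1) ((μ.map fun x => act (M x)⁻¹ x).prod η) μ := by
  have hΦ : Measurable fun p : X × B => act p.2 p.1 := hact.comp measurable_swap
  refine ⟨hΦ, ?_⟩
  rw [← map_normalise_average_eq_prod η μ hact hmul hinv hM hcov,
    Measure.map_map hΦ ((measurable_normalise hact hM).prodMk hM)]
  have hid : ((fun p : X × B => act p.2 p.1) ∘ fun x => (act (M x)⁻¹ x, M x)) = id := by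
    funext x
    exact act_average_normalise hone hmul x
  rw [hid, Measure.map_id]

end Disintegration

/-! ## §3 The window about a section of the average, read on the unit fibre -/

section Window

/-- **PRINT'S WINDOW ON THE UNIT FIBRE.**  For an `act`-invariant distance-like function `d` and ANY section-centre
`σ : B → X` («centre read off the configuration's own average»), the window `1{d(x, σ(M x)) < r}` at the translate
`act g w` of a unit-fibre point `w` IS the ball `1{d(w, act g⁻¹ (σ g)) < r}` — its centre FROZEN with the average
value `g`. [folklore] -/
theorem window_translate (hone : ∀ x, act 1 x = x) (hmul : ∀ g h x, act (g * h) x = act h (act g x))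
    (hcov : ∀ g x, M (act g x) = M x * g) {d : X → X → ℝ} (hd : ∀ g x y, d (act g x) (act g y) = d x y)
    (σ : B → X) (r : ℝ) (g : B) {w : X} (hw : M w = 1) :
    {x | d x (σ (M x)) < r}.indicator (1 : X → ℝ≥0∞) (act g w) =
      {v | d v (act g⁻¹ (σ g)) < r}.indicator 1 w := by
  have key : d (act g w) (σ (M (act g w))) = d w (act g⁻¹ (σ g)) := by
    rw [average_translate_unit hcov hw, ← hd g⁻¹ (act g w) (σ g), ← hmul, mul_inv_cancel, hone]
  by_cases h : d w (act g⁻¹ (σ g)) < r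
  · rw [indicator_of_mem (show act g w ∈ {x | d x (σ (M x)) < r} by rw [mem_setOf_eq, key]; exact h),
      indicator_of_mem (show w ∈ {v | d v (act g⁻¹ (σ g)) < r} from h)]
    rfl
  · rw [indicator_of_notMem (show act g w ∉ {x | d x (σ (M x)) < r} by rw [mem_setOf_eq, key]; exact h),
      indicator_of_notMem (show w ∉ {v | d v (act g⁻¹ (σ g)) < r} from h)]

/-- **COVARIANT CENTRE ⇒ FIXED BALL.**  If the centre is a COVARIANT section, `σ g = act g c`, the window on the unit
fibre is the FIXED ball `1{d(w, c) < r}` — for every average value `g`: no `hc`, no smallness, no linearity.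
[folklore] -/
theorem window_translate_covariant (hone : ∀ x, act 1 x = x) (hmul : ∀ g h x, act (g * h) x = act h (act g x))
    (hcov : ∀ g x, M (act g x) = M x * g) {d : X → X → ℝ} (hd : ∀ g x y, d (act g x) (act g y) = d x y)
    {σ : B → X} {c : X} (hσ : ∀ g, σ g = act g c) (r : ℝ) (g : B) {w : X} (hw : M w = 1) :
    {x | d x (σ (M x)) < r}.indicator (1 : X → ℝ≥0∞) (act g w) = {v | d v c < r}.indicator 1 w := by
  rw [window_translate hone hmul hcov hd σ r g hw, hσ g, ← hmul, mul_inv_cancel, hone]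

end Window

/-! ## §4 (M1) through the translates and fibrewise -/

section AntiConcentration

variable [MeasurableSpace B] [MeasurableMul₂ B] [MeasurableInv B] [MeasurableSpace X] (μ : Measure X)
  [IsFiniteMeasure μ]

/-- **(M1) THROUGH THE TRANSLATES**: (M1) for `μ.withDensity G` with tested variable `u` FOLLOWS from (M1) for
`(ν₁ ⊗ η).withDensity (G ∘ translate)` with `u ∘ translate`, SAME `θ ρ D`. [folklore] -/
theorem slotAC_of_translate (η : Measure B) [IsProbabilityMeasure η] [η.IsMulLeftInvariant]
    (hact : Measurable fun p : B × X => act p.1 p.2) (hone : ∀ x, act 1 x = x)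
    (hmul : ∀ g h x, act (g * h) x = act h (act g x)) (hinv : ∀ g, MeasurePreserving (act g) μ μ)
    (hM : Measurable M) (hcov : ∀ g x, M (act g x) = M x * g) {G : X → ℝ≥0∞} (hG : Measurable G)
    {u : X → ℝ} (hu : Measurable u) {θ ρ D : ℝ}
    (h : SlotAntiConcentration (((μ.map fun x => act (M x)⁻¹ x).prod η).withDensity fun p => G (act p.2 p.1))
      (fun p => u (act p.2 p.1)) θ ρ D) :
    SlotAntiConcentration (μ.withDensity G) u θ ρ D :=
  slotAntiConcentration_withDensity_map (measurePreserving_translate η μ hact hone hmul hinv hM hcov) hG hu h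

/-- **(M1) FROM THE UNIT FIBRE, THE AVERAGE FROZEN**: (M1) for `μ.withDensity G` FOLLOWS from (M1), for every value
`g` of the average, of the unit-fibre law `ν₁` tilted by `w ↦ G (act g w)` with variable `w ↦ u (act g w)`, SAME
`θ ρ D`. [folklore] -/
theorem slotAC_of_unitFibre (η : Measure B) [IsProbabilityMeasure η] [η.IsMulLeftInvariant]
    (hact : Measurable fun p : B × X => act p.1 p.2) (hone : ∀ x, act 1 x = x)
    (hmul : ∀ g h x, act (g * h) x = act h (act g x)) (hinv : ∀ g, MeasurePreserving (act g) μ μ)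
    (hM : Measurable M) (hcov : ∀ g x, M (act g x) = M x * g) {G : X → ℝ≥0∞} (hG : Measurable G)
    {u : X → ℝ} (hu : Measurable u) {θ ρ D : ℝ}
    (h : ∀ g : B, SlotAntiConcentration ((μ.map fun x => act (M x)⁻¹ x).withDensity fun w => G (act g w))
      (fun w => u (act g w)) θ ρ D) :
    SlotAntiConcentration (μ.withDensity G) u θ ρ D :=
  have hΦ : Measurable fun p : X × B => act p.2 p.1 := hact.comp measurable_swap
  slotAC_of_translate μ η hact hone hmul hinv hM hcov hG hu
    (slotAntiConcentration_of_sections (μ.map fun x => act (M x)⁻¹ x) η (hG.comp hΦ) (hu.comp hΦ) h)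

/-- **WITH AN EXTERIOR.**  The realized slot law `((μ.prod ζ).withDensity G)` — configuration law × ANY s-finite
exterior law, density `G` — satisfies (M1) as soon as, for every exterior point `z` and every value `g` of the
average, the unit-fibre law tilted by `w ↦ G (act g w, z)` does (variable `w ↦ u (act g w, z)`, SAME `θ ρ D`).
[folklore] -/
theorem slotAC_covariant_of_fibrewise (η : Measure B) [IsProbabilityMeasure η] [η.IsMulLeftInvariant]
    {Z : Type*} [MeasurableSpace Z] (ζ : Measure Z) [SFinite ζ]
    (hact : Measurable fun p : B × X => act p.1 p.2) (hone : ∀ x, act 1 x = x)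
    (hmul : ∀ g h x, act (g * h) x = act h (act g x)) (hinv : ∀ g, MeasurePreserving (act g) μ μ)
    (hM : Measurable M) (hcov : ∀ g x, M (act g x) = M x * g) {G : X × Z → ℝ≥0∞} (hG : Measurable G)
    {u : X × Z → ℝ} (hu : Measurable u) {θ ρ D : ℝ}
    (h : ∀ (z : Z) (g : B), SlotAntiConcentration ((μ.map fun x => act (M x)⁻¹ x).withDensity fun w =>
      G (act g w, z)) (fun w => u (act g w, z)) θ ρ D) :
    SlotAntiConcentration ((μ.prod ζ).withDensity G) u θ ρ D :=
  slotAntiConcentration_of_sections μ ζ hG hu fun z =>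
    slotAC_of_unitFibre μ η hact hone hmul hinv hM hcov (hG.comp measurable_prodMk_right)
      (hu.comp measurable_prodMk_right) (h z)

/-- **END — WINDOW ABOUT A SECTION OF THE AVERAGE (marginal reading, any section).**  Realized slot law
`((μ.prod ζ).withDensity (1{d(x, σ_z(M x)) < r} · G₀))`: the configuration law windowed about a jointly measurable
section-centre `σ z (M x)` of its own average (× weights `G₀`, × any s-finite exterior law).  (M1) for it FOLLOWS from
(M1), per `(z, g)`, of the unit-fibre law tilted by the ball `1{d(w, act g⁻¹ (σ z g)) < r}` — centre frozen with
`(z, g)` — times `G₀ (act g w, z)`.  The per-fibre (M1) is where E2′'s level data enter (through a chart of the unit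
fibre — (CH), displayed); nothing printed is asserted. [folklore] -/
theorem slotAC_sectionWindow_of_fibrewise (η : Measure B) [IsProbabilityMeasure η] [η.IsMulLeftInvariant]
    {Z : Type*} [MeasurableSpace Z] (ζ : Measure Z) [SFinite ζ]
    [MeasurableSingletonClass B] (hact : Measurable fun p : B × X => act p.1 p.2) (hone : ∀ x, act 1 x = x)
    (hmul : ∀ g h x, act (g * h) x = act h (act g x)) (hinv : ∀ g, MeasurePreserving (act g) μ μ)
    (hM : Measurable M) (hcov : ∀ g x, M (act g x) = M x * g) {d : X → X → ℝ}
    (hd : ∀ g x y, d (act g x) (act g y) = d x y) (hdm : Measurable fun p : X × X => d p.1 p.2)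
    (σ : Z → B → X) (hσm : Measurable fun p : Z × B => σ p.1 p.2) (r : ℝ) {G₀ : X × Z → ℝ≥0∞}
    (hG₀ : Measurable G₀) {u : X × Z → ℝ} (hu : Measurable u) {θ ρ D : ℝ}
    (h : ∀ (z : Z) (g : B), SlotAntiConcentration ((μ.map fun x => act (M x)⁻¹ x).withDensity fun w =>
      {v | d v (act g⁻¹ (σ z g)) < r}.indicator 1 w * G₀ (act g w, z)) (fun w => u (act g w, z)) θ ρ D) :
    SlotAntiConcentration ((μ.prod ζ).withDensity fun p => {x | d x (σ p.2 (M x)) < r}.indicator 1 p.1 * G₀ p)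
      u θ ρ D := by
  -- measurability of the windowed density
  have hWset : MeasurableSet {p : X × Z | d p.1 (σ p.2 (M p.1)) < r} :=
    measurableSet_lt (hdm.comp (measurable_fst.prodMk (hσm.comp (measurable_snd.prodMk (hM.comp measurable_fst)))))
      measurable_const
  have hind : (fun p : X × Z => {x | d x (σ p.2 (M x)) < r}.indicator (1 : X → ℝ≥0∞) p.1) =
      {p : X × Z | d p.1 (σ p.2 (M p.1)) < r}.indicator 1 := by
    funext p
    by_cases hp : d p.1 (σ p.2 (M p.1)) < r
    · rw [indicator_of_mem (show p.1 ∈ {x | d x (σ p.2 (M x)) < r} from hp),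
        indicator_of_mem (show p ∈ {p : X × Z | d p.1 (σ p.2 (M p.1)) < r} from hp)]
      rfl
    · rw [indicator_of_notMem (show p.1 ∉ {x | d x (σ p.2 (M x)) < r} from hp),
        indicator_of_notMem (show p ∉ {p : X × Z | d p.1 (σ p.2 (M p.1)) < r} from hp)]
  have hI : Measurable fun p : X × Z => {x | d x (σ p.2 (M x)) < r}.indicator (1 : X → ℝ≥0∞) p.1 := by
    rw [hind]
    exact measurable_one.indicator hWset
  have hGm : Measurable fun p : X × Z => {x | d x (σ p.2 (M x)) < r}.indicator (1 : X → ℝ≥0∞) p.1 * G₀ p :=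
    hI.mul hG₀
  refine slotAC_covariant_of_fibrewise μ η ζ hact hone hmul hinv hM hcov hGm hu fun z g => ?_
  -- on the unit fibre the window is the frozen-centre ball (a.e. for the unit-fibre law)
  have hae : (fun w => {x | d x (σ z (M x)) < r}.indicator (1 : X → ℝ≥0∞) (act g w) * G₀ (act g w, z))
      =ᵐ[μ.map fun x => act (M x)⁻¹ x]
      (fun w => {v | d v (act g⁻¹ (σ z g)) < r}.indicator 1 w * G₀ (act g w, z)) := by
    filter_upwards [ae_normalise_unit μ hact hM hcov] with w hw
    rw [window_translate hone hmul hcov hd (σ z) r g hw]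
  rw [withDensity_congr_ae hae]
  exact h z g

/-- **END — COVARIANT CENTRE: THE WINDOW IS A FIXED BALL ON THE UNIT FIBRE.**  Same, for a covariant section-centre
`σ z g = act g (c z)` (measurable `c`): per `(z, g)` the density on the unit fibre is `1{d(w, c z) < r} · G₀(act g w, z)`
— a FIXED-centre ball co-test in the fibre variable for every value of the average (S20's `hc` and gen 2's
conditional reading become vacuous in this model).  CONDITIONAL on the per-fibre (M1); the translation structure is
the MODEL; nothing printed is asserted. [folklore] -/
theorem slotAC_covariantWindow_of_fibrewise (η : Measure B) [IsProbabilityMeasure η] [η.IsMulLeftInvariant]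
    {Z : Type*} [MeasurableSpace Z] (ζ : Measure Z) [SFinite ζ]
    [MeasurableSingletonClass B] (hact : Measurable fun p : B × X => act p.1 p.2) (hone : ∀ x, act 1 x = x)
    (hmul : ∀ g h x, act (g * h) x = act h (act g x)) (hinv : ∀ g, MeasurePreserving (act g) μ μ)
    (hM : Measurable M) (hcov : ∀ g x, M (act g x) = M x * g) {d : X → X → ℝ}
    (hd : ∀ g x y, d (act g x) (act g y) = d x y) (hdm : Measurable fun p : X × X => d p.1 p.2)
    {c : Z → X} (hc : Measurable c) (r : ℝ) {G₀ : X × Z → ℝ≥0∞} (hG₀ : Measurable G₀) {u : X × Z → ℝ}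
    (hu : Measurable u) {θ ρ D : ℝ}
    (h : ∀ (z : Z) (g : B), SlotAntiConcentration ((μ.map fun x => act (M x)⁻¹ x).withDensity fun w =>
      {v | d v (c z) < r}.indicator 1 w * G₀ (act g w, z)) (fun w => u (act g w, z)) θ ρ D) :
    SlotAntiConcentration ((μ.prod ζ).withDensity fun p =>
      {x | d x (act (M x) (c p.2)) < r}.indicator 1 p.1 * G₀ p) u θ ρ D := by
  have hσm : Measurable fun p : Z × B => act p.2 (c p.1) := hact.comp (measurable_snd.prodMk (hc.comp measurable_fst))
  refine slotAC_sectionWindow_of_fibrewise μ η ζ hact hone hmul hinv hM hcov hd hdm (fun z g => act g (c z))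
    hσm r hG₀ hu fun z g => ?_
  have heq : act g⁻¹ (act g (c z)) = c z := by rw [← hmul, mul_inv_cancel, hone]
  simpa only [heq] using h z g

end AntiConcentration

end Summit.QuantumFields.BalabanUV.T4Continuum.ShellMeasureWindowCovariant

end
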